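import Summits.QuantumFields.YangMills.Theorems.BalabanUVNodesN15KingModelSlicesTorus
import Summits.QuantumFields.YangMills.Theorems.BalabanUVNodesN15KingModelCurvedSlicesNode

/-!
# BalabanUVNodes ∕ N15 — THE KING-MODEL RUNG, CURVED EDITION (PART G): THE `A = 0` TORUS MEMBER OF THE SLICE FAMILY — King's assembled
# single-scale piece (part F) at two spacings as the schema's `TwoSpacing` datum with point fibres, its (3.73)-line-1 shape PROVED
# (`(L^{−γ′})^j = L^{−γ′k}(L^jη)^{−γ′}` IS King's factor), and NE2's `EtaRateIneqSite (d+1) (−2)` ∕ `NE2PlusSite` through part E's exact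
# dictionary, hypothesis-free
# (Track A, DAG node N15 = NE2; FAN-OUT v1.1 §N15 s3 «KING-MODEL RUNG … + the one-line statement of what the curved case adds»)

HONEST FRAMING.  Count-neutral kernel bookkeeping (cell `pub-ymgap`, seat `pub-ymgap-dag-n15-e` g4; `--supports stmt-QuantumFields-19908
--as helper` = K3′ `SpineGivenEndpointR12`, lineage K3 19676).  TEMPLATE LITERATURE, `A = 0`: King's scalar MODEL on finite tori, the KING-TYPE
single-scale pieces of part F (`…N15KingModelSlicesTorus`: HONEST SCOPE (ii) lattice units, (iii) mass fixed in scale-`j` units — a MODEL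
member family, not a transcription of (2.17)); NOT Bałaban's `G(U)`; NE2⁺ for Bałaban's objects is NOT PRINTED and not proved; NOT a node
discharge; nothing continuum ∕ ℝ⁴ ∕ OS ∕ mass-gap ∕ Clay.  0 `sorry`, standard axioms; plumbing `def`s (a point section, the datum, its
point fibres, the family map).

THE POINT.  Parts D–E typed NE2's site layer on the multiscale slice carrier and proved `EtaRateIneqSite d (−2) ⟺ (3.73) line 1` exactly, with
the one-point smoke member only; part F assembled King's `A = 0` single-scale piece on the torus and PROVED its two-spacing rate
`C·(L^{−γ∕2})^j·e^{−δ|B(x) − B(y)|_U}` (`ksSlice_rate`).  THIS PART closes the loop: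
* §1 `overPtN` (a fine point over each coarse point: `x′_μ = L^n·x_μ`, `underPtN_overPtN`), the datum **`kSliceData L a m² i : TwoSpacing (d+1)`**
  (coarse run `k = j + e + 1 − m₀` steps on `T_η = Tor (fine L^j U)`, fine run `k + n` on `Tor (fine (L^nL^j) U)`, `pt = underPtN`, slice
  kernel at every slice index := the scale-`j` piece `ksSlice` ∕ `ksSlice′` (the family reads index `j` only), `dist(x, y) = (L^jη)·|B(x) − B(y)|_U`
  = King's `|x − y|` read block-wise in physical units; gradients ∕ contour kernels ∕ Prop-3.8 legs not instantiated), its point fibres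
  `kSlicePB` (a `PointBlocking`: all fine points over `x`, nonempty by `overPtN`), the family map **`kSliceIndex : KSliceIdx d → SlicesIndex (d+1)`**;
* §2 the scale algebra `slice_rate_identity`: `L^{−γ′k}·(L^jη)^{−γ′} = (L^{−γ′})^j` (`η = L^{−k}`) — the rate part F proves IS King's factor of
  (3.73); `kSlice_slice_le_one` (`L^jη ≤ 1`); and **`line1_kSlices`**: (3.73) LINE 1 AT SLICE `j` FOR THE DATUM, every index, ONE `(C, δ)` —
  `|G′_{(j)}(x′, y′) − G_{(j)}(x, y)| ≤ C·L^{−γ′k}(L^jη)^{2−(d+1)−γ′}·e^{−δ(L^jη)^{−1}dist(x, y)}` with `γ′ = γ∕2` (the prefactor `(L^jη)^{1−d} ≥ 1` for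
  `d ≥ 1` absorbs the lattice-unit `O(1)`: part F HONEST SCOPE (ii));
* §3 THROUGH PART E: **`etaRateIneqSite_kSlices`** (`EtaRateIneqSite (d+1) (−2) (slicesGSite (kSliceIndex … i)) C δ (γ∕2) U`, every index, one
  `(C, δ)` — part E's `etaRateIneqSite_slicesG_iff_line1`), **`ne2PlusSite_kSlices`** (`NE2PlusSite (d+1) (−2) c35` on the whole family,
  constants `(1, δ, 1, C, γ∕2)`, part E's `ne2PlusSite_slicesG_of_line1`), `ne2ZeroSite_kSlices`, and the readout instance
  `exists_line1_kSlices` (part E's `exists_line1_of_ne2PlusSite_slicesG` returns the shape — round trip); the index is inhabited by part F's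
  `kSliceIdx_nonempty`.
WHAT BAŁABAN'S CASE STILL ADDS: as parts D∕F — the non-abelian covariant `G(U)` (operator class, test-function reading), the live window inside
one instance, an η-difference statement at all; and, inside King's model, the `A ≠ 0` slices themselves (Prop. 3.9 is consumed as a schema by
parts D–E, proved here only at `A = 0` in the KING-TYPE form of part F).
Locators: [King1986] C. King, CMP **102** (1986) 649–677: (2.17), (2.20) pp. 653–654, p. 664 (pairing sentence), Prop. 3.9 (3.73) p. 665,
(4.42)–(4.43) p. 675; [B9] = [Balaban1985BackgroundPropagators] Thm 3.2 (3.48) p. 398, (3.132) p. 422, Thm 3.14 pp. 426–427 (typing template).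
-/

noncomputable section

namespace Summit.QuantumFields.YangMills.BalabanUVNodes.N15KingModelRung.Curved

open Real Finset
open Literature.MathematicalPhysics.QuantumFieldTheory.Balaban1983to89.T4EtaRate (EtaRateIneqSite NE2PlusSite)
open Literature.MathematicalPhysics.QuantumFieldTheory.Balaban1983to89.T4EtaRateSiteOfRatePair (NE2ZeroSite ne2ZeroSite_of_ne2PlusSite)
open Literature.MathematicalPhysics.QuantumFieldTheory.Balaban1983to89.B5Prop11Plancherel (Tor fine)
open Literature.MathematicalPhysics.QuantumFieldTheory.King1986.ContinuumLimit (eps eps_pos eps_le_one)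
open Literature.MathematicalPhysics.QuantumFieldTheory.King1986.Torus (blockOf tdistT tdistT_nonneg)
open Literature.MathematicalPhysics.QuantumFieldTheory.King1986.SlicePropagator (SliceKernels TwoSpacing)

variable {d : ℕ}

/-! ## §1 The datum: King's `A = 0` single-scale piece at two spacings, its point fibres, the family map -/

section Object

variable (L : ℕ) [NeZero L]

/-- A FINE POINT OVER EACH COARSE POINT: `x′_μ = L^n·x_μ` (the corner of `B^n(x)`). [cite: King1986, p.664 («x′ ∈ B^n(x)»)] -/
def overPtN (K n : ℕ) (M : Fin (d + 1) → ℕ) (x : Tor (fine (L ^ K) M)) : Tor (fine (L ^ n * L ^ K) M) :=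
  fun μ => (((x μ).val * L ^ n : ℕ) : ZMod (fine (L ^ n * L ^ K) M μ))

/-- Its coordinates: `x′_μ = L^n·x_μ` (no wrap-around). [folklore] -/
theorem val_overPtN (K n : ℕ) (M : Fin (d + 1) → ℕ) [∀ μ, NeZero (M μ)] (x : Tor (fine (L ^ K) M)) (μ : Fin (d + 1)) :
    (overPtN L K n M x μ).val = (x μ).val * L ^ n := by
  have hlt : (x μ).val < L ^ K * M μ := ZMod.val_lt (x μ)
  have hLn : 0 < L ^ n := pow_pos (Nat.pos_of_ne_zero (NeZero.ne L)) n
  have hlt' : (x μ).val * L ^ n < L ^ n * L ^ K * M μ := by nlinarith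
  show ((((x μ).val * L ^ n : ℕ) : ZMod (L ^ n * L ^ K * M μ))).val = (x μ).val * L ^ n
  rw [ZMod.val_natCast, Nat.mod_eq_of_lt hlt']

/-- `x′ = overPtN x` lies over `x`: `underPtN (overPtN x) = x`. [cite: King1986, p.664 («x′ ∈ B^n(x)»)] -/
theorem underPtN_overPtN (K n : ℕ) (M : Fin (d + 1) → ℕ) [∀ μ, NeZero (M μ)] (x : Tor (fine (L ^ K) M)) :
    underPtN L K n M (overPtN L K n M x) = x := by
  funext μ
  apply ZMod.val_injective
  rw [val_underPtN, val_overPtN]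
  exact Nat.mul_div_cancel _ (pow_pos (Nat.pos_of_ne_zero (NeZero.ne L)) n)

/-- The number of scales of the coarse run of an index: `k = j + (e + 1 − m₀)` (physical volume `2L^{m₀}`, scale-`j` lattice of side `2L^{e+1}`).
[cite: King1986, (3.10) p.656 (running scale bookkeeping)] -/
def KSliceIdx.k (i : KSliceIdx d) : ℕ := i.j + (i.e + 1 - i.m₀)

/-- The slice is internal: `j + 1 ≤ k`. [cite: King1986, Prop. 3.9 p.665 (range `0 ≤ j ≤ k − 1`)] -/
theorem KSliceIdx.j_succ_le_k (i : KSliceIdx d) : i.j + 1 ≤ i.k := by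
  have := i.m₀_le
  unfold KSliceIdx.k
  omega

variable (a m2 : ℝ)

/-- THE COARSE RUN'S SLICE DATA: sites `T_η = Tor (fine L^j U)`, `k` scales, block factor `L`, the distance `(L^jη)·|B(x) − B(y)|_U` (King's
`|x − y|` read block-wise in physical units, `η = L^{−k}`), and the slice kernel := part F's scale-`j` piece at EVERY slice index (only index
`j` is read by the family); gradients ∕ contour kernels ∕ bonds not instantiated. [cite: King1986, (2.17) p.653, (4.42) p.675] -/
@[reducible] def kSliceLo (i : KSliceIdx d) : SliceKernels (d + 1) where
  S := Tor (fine (L ^ i.j) (ksU L i))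
  B := Unit
  dist := fun x y => ((L : ℝ) ^ i.j * eps L i.k) * tdistT (ksU L i) (blockOf (L ^ i.j) (ksU L i) x) (blockOf (L ^ i.j) (ksU L i) y)
  distBlockBond := fun _ _ _ => 0
  L := L
  k := i.k
  G := fun _ x y => ksSlice L a m2 i x y
  dG := fun _ _ _ _ => 0
  Gc := fun _ _ _ => 0

/-- THE FINE RUN'S SLICE DATA: sites `T_{η′} = Tor (fine (L^nL^j) U)`, `k + n` scales, the slice kernel := part F's fine piece. [cite: King1986, (2.17) p.653, (4.42) p.675] -/
@[reducible] def kSliceHi (i : KSliceIdx d) : SliceKernels (d + 1) where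
  S := Tor (fine (L ^ i.n * L ^ i.j) (ksU L i))
  B := Unit
  dist := fun x' y' => ((L : ℝ) ^ i.j * eps L i.k)
    * tdistT (ksU L i) (blockOf (L ^ i.n * L ^ i.j) (ksU L i) x') (blockOf (L ^ i.n * L ^ i.j) (ksU L i) y')
  distBlockBond := fun _ _ _ => 0
  L := L
  k := i.k + i.n
  G := fun _ x' y' => ksSlice' L a m2 i x' y'
  dG := fun _ _ _ _ => 0
  Gc := fun _ _ _ => 0

/-- **KING'S `A = 0` SINGLE-SCALE PIECE AT TWO SPACINGS AS THE SCHEMA's `TwoSpacing` DATUM**: coarse ∕ fine runs as above, `n` extra scales,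
King's point map `pt = underPtN`; the Prop-3.8 legs `K, dK, K′, dK′` are not instantiated here (they are part C's datum). [cite: King1986, p.664 (two spacings), Prop. 3.9 (3.73) p.665 (objects)] -/
@[reducible] def kSliceData (i : KSliceIdx d) : TwoSpacing (d + 1) where
  lo := kSliceLo L a m2 i
  hi := kSliceHi L a m2 i
  n := i.n
  k_hi := rfl
  L_hi := rfl
  pt := underPtN L i.j i.n (ksU L i)
  bd := fun b => b
  IsUnit := fun _ => True
  K := fun _ _ => 0
  dK := fun _ _ _ => 0
  K' := fun _ _ => 0
  dK' := fun _ _ _ => 0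

/-- **ITS POINT FIBRES**: all fine points over `x` (a finite set of the fine torus), nonempty by `overPtN`. [cite: King1986, p.664 («x′ ∈ B^n(x)»)] -/
def kSlicePB (i : KSliceIdx d) : PointBlocking (kSliceData L a m2 i) where
  fibre := fun x => (Finset.univ : Finset (Tor (fine (L ^ i.n * L ^ i.j) (ksU L i)))).filter
    fun x' => underPtN L i.j i.n (ksU L i) x' = x
  mem_fibre := fun x x' => by
    rw [Finset.mem_filter]
    exact and_iff_right (Finset.mem_univ _)
  fibre_nonempty := fun x => ⟨overPtN L i.j i.n (ksU L i) x, by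
    rw [Finset.mem_filter]
    exact ⟨Finset.mem_univ _, underPtN_overPtN L i.j i.n (ksU L i) x⟩⟩

/-- THE FAMILY MAP into parts D–E's slice index (datum, point fibres, slice `j` with `j + 1 ≤ k`, size letter, `L > 1`). [folklore] -/
def kSliceIndex (hL : 2 ≤ L) (i : KSliceIdx d) : SlicesIndex (d + 1) :=
  ⟨kSliceData L a m2 i, kSlicePB L a m2 i, i.j, i.j_succ_le_k, i.Msz, i.one_le_Msz, by show 1 < L; omega⟩

end Object

/-! ## §2 (3.73) line 1 at slice `j` for the datum, every index: one constant for all volumes, slices and spacing ratios -/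

section Lines

variable (L : ℕ) [NeZero L]

omit [NeZero L] in
/-- **THE RATE IS KING'S FACTOR**: `L^{−γ′k}·(L^jη)^{−γ′} = (L^{−γ′})^j` for `η = L^{−k}`, `L > 0` (`T4EtaRate.rateFactor_eq_king` read backwards:
the rate factor at scale `j` is `L^{−γ′j}`). [cite: King1986, Prop. 3.9 (3.73) p.665, (4.43) p.675 («L^{−γj} = L^{−γk}(L^jη)^{−γ}»)] -/
theorem slice_rate_identity (hL : 0 < L) (γ' : ℝ) (j k : ℕ) :
    (L : ℝ) ^ (-(γ' * k)) * ((L : ℝ) ^ j * eps L k) ^ (-γ') = ((L : ℝ) ^ (-γ')) ^ j := by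
  have hL' : (0 : ℝ) < L := by exact_mod_cast hL
  have hslice : (L : ℝ) ^ j * eps L k = (L : ℝ) ^ ((j : ℝ) - k) := by
    rw [eps, ← Real.rpow_natCast, ← Real.rpow_natCast, ← Real.rpow_neg hL'.le, ← Real.rpow_add hL']
    ring_nf
  rw [hslice, ← Real.rpow_mul hL'.le, ← Real.rpow_add hL', ← Real.rpow_natCast, ← Real.rpow_mul hL'.le]
  congr 1
  ring

omit [NeZero L] in
/-- An internal slice is not larger than the unit scale: `L^jη ≤ 1` for `j ≤ k`, `L ≥ 1`; and `L^jη > 0`. [cite: King1986, (3.63) p.663] -/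
theorem kSlice_slice_pos_le_one (hL : 1 ≤ L) {j k : ℕ} (hjk : j ≤ k) :
    0 < (L : ℝ) ^ j * eps L k ∧ (L : ℝ) ^ j * eps L k ≤ 1 := by
  have hL0 : 0 < L := hL
  have hL' : (1 : ℝ) ≤ L := by exact_mod_cast hL
  refine ⟨mul_pos (pow_pos (by exact_mod_cast hL0) _) (eps_pos hL0 k), ?_⟩
  rw [eps, ← div_eq_mul_inv, div_le_one (pow_pos (by exact_mod_cast hL0) _)]
  exact pow_le_pow_right₀ hL' hjk

/-- **(3.73) LINE 1 AT SLICE `j` FOR KING'S `A = 0` DATUM, EVERY INDEX, ONE `(C, δ)`** (`d ≥ 1`, odd `L ≥ 3`, `a, m² > 0`, `0 ≤ γ ≤ 1`, `γ′ = γ∕2`):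
`|G′_{(j)}(x′, y′) − G_{(j)}(x, y)| ≤ C·L^{−γ′k}(L^jη)^{2−(d+1)−γ′}·e^{−δ(L^jη)^{−1}dist(x, y)}` for all fine `x′, y′` (`x, y` under them) — part F's
`ksSlice_rate`, the rate rewritten by `slice_rate_identity`, the prefactor `(L^jη)^{1−d} ≥ 1` absorbing the lattice-unit `O(1)` (part F (ii)),
the exponent `(L^jη)^{−1}·dist = |B(x) − B(y)|_U` by construction. [cite: King1986, Prop. 3.9 (3.73) p.665 (first line, `A = 0`), (4.42)–(4.43) p.675] -/
theorem line1_kSlices (hd : 1 ≤ d) (hLodd : Odd L) (hL : 2 ≤ L) {a m2 : ℝ} (ha : 0 < a) (hm : 0 < m2) {γ : ℝ} (hγ0 : 0 ≤ γ)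
    (hγ1 : γ ≤ 1) :
    ∃ C δ : ℝ, 0 < C ∧ 0 < δ ∧ ∀ (i : KSliceIdx d) (x' y' : (kSliceData L a m2 i).hi.S),
      |(kSliceData L a m2 i).hi.G i.j x' y' - (kSliceData L a m2 i).lo.G i.j ((kSliceData L a m2 i).pt x') ((kSliceData L a m2 i).pt y')|
        ≤ C * ((kSliceData L a m2 i).lo.L : ℝ) ^ (-(γ / 2 * (kSliceData L a m2 i).lo.k))
          * ((kSliceData L a m2 i).lo.slice i.j) ^ ((2 : ℝ) - ((d + 1 : ℕ) : ℝ) - γ / 2)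
          * Real.exp (-(δ * ((kSliceData L a m2 i).lo.slice i.j)⁻¹
              * (kSliceData L a m2 i).lo.dist ((kSliceData L a m2 i).pt x') ((kSliceData L a m2 i).pt y'))) := by
  have hL0 : 0 < L := by omega
  obtain ⟨C, δ, hC, hδ, H⟩ := ksSlice_rate (d := d) L hLodd hL ha hm hγ0 hγ1
  refine ⟨C, δ, hC, hδ, fun i x' y' => ?_⟩
  have h := H i x' y'
  -- the slice length of the datum
  have hsl : (kSliceData L a m2 i).lo.slice i.j = (L : ℝ) ^ i.j * eps L i.k := rfl
  obtain ⟨hsl0, hsl1⟩ := kSlice_slice_pos_le_one (L := L) (by omega) (le_of_lt i.j_succ_le_k)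
  set sl : ℝ := (L : ℝ) ^ i.j * eps L i.k with hsl_def
  set t : ℝ := tdistT (ksU L i) (blockOf (L ^ i.j) (ksU L i) (underPtN L i.j i.n (ksU L i) x'))
    (blockOf (L ^ i.j) (ksU L i) (underPtN L i.j i.n (ksU L i) y')) with ht
  -- the exponent: `(L^jη)^{−1}·((L^jη)·t) = t`
  have hexp : Real.exp (-(δ * sl⁻¹ * (sl * t))) = Real.exp (-(δ * t)) := by
    rw [mul_assoc, inv_mul_cancel_left₀ hsl0.ne']
  -- the rate: `(L^{−γ∕2})^j = L^{−(γ∕2)k}·(L^jη)^{−γ∕2} ≤ L^{−(γ∕2)k}·(L^jη)^{2−(d+1)−γ∕2}`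
  have hrate : ((L : ℝ) ^ (-(γ / 2))) ^ i.j = (L : ℝ) ^ (-(γ / 2 * i.k)) * sl ^ (-(γ / 2)) :=
    (slice_rate_identity L hL0 (γ / 2) i.j i.k).symm
  have hd' : (2 : ℝ) - ((d + 1 : ℕ) : ℝ) - γ / 2 ≤ -(γ / 2) := by
    have : (1 : ℝ) ≤ d := by exact_mod_cast hd
    push_cast
    linarith
  have hpref : sl ^ (-(γ / 2)) ≤ sl ^ ((2 : ℝ) - ((d + 1 : ℕ) : ℝ) - γ / 2) :=
    Real.rpow_le_rpow_of_exponent_ge hsl0 hsl1 hd'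
  have hLk : 0 ≤ (L : ℝ) ^ (-(γ / 2 * i.k)) := Real.rpow_nonneg (Nat.cast_nonneg _) _
  rw [hsl, hexp]
  calc |ksSlice' L a m2 i x' y' - ksSlice L a m2 i (underPtN L i.j i.n (ksU L i) x') (underPtN L i.j i.n (ksU L i) y')|
      ≤ C * ((L : ℝ) ^ (-(γ / 2))) ^ i.j * Real.exp (-(δ * t)) := h
    _ = C * ((L : ℝ) ^ (-(γ / 2 * i.k)) * sl ^ (-(γ / 2))) * Real.exp (-(δ * t)) := by rw [hrate]
    _ ≤ C * ((L : ℝ) ^ (-(γ / 2 * i.k)) * sl ^ ((2 : ℝ) - ((d + 1 : ℕ) : ℝ) - γ / 2)) * Real.exp (-(δ * t)) :=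
        mul_le_mul_of_nonneg_right (mul_le_mul_of_nonneg_left (mul_le_mul_of_nonneg_left hpref hLk) hC.le) (Real.exp_pos _).le
    _ = C * (L : ℝ) ^ (-(γ / 2 * i.k)) * sl ^ ((2 : ℝ) - ((d + 1 : ℕ) : ℝ) - γ / 2) * Real.exp (-(δ * t)) := by ring

end Lines

/-! ## §3 Through part E's dictionary: NE2's site layer for King's `A = 0` slices, every index, hypothesis-free -/

section Pipeline

variable (L : ℕ) [NeZero L]

/-- **THE TYPED SITE INEQUALITY FOR THE KING `A = 0` SLICE MEMBERS** (`d ≥ 1`, odd `L ≥ 3`, `a, m² > 0`, `0 ≤ γ ≤ 1`): ONE `(C, δ)` such that for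
EVERY index and the (unique) background, `EtaRateIneqSite (d+1) (−2) (slicesGSite (kSliceIndex L a m² hL i)) C δ (γ∕2) U` — part E's exact
dictionary `etaRateIneqSite_slicesG_iff_line1` fed §2's `line1_kSlices`. [cite: King1986, Prop. 3.9 (3.73) p.665; Balaban1985BackgroundPropagators, Thm 3.2 (3.48) p.398 + (3.132) p.422 (shape)] -/
theorem etaRateIneqSite_kSlices (hd : 1 ≤ d) (hLodd : Odd L) (hL : 2 ≤ L) {a m2 : ℝ} (ha : 0 < a) (hm : 0 < m2) {γ : ℝ}
    (hγ0 : 0 ≤ γ) (hγ1 : γ ≤ 1) :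
    ∃ C δ : ℝ, 0 < C ∧ 0 < δ ∧ ∀ (i : KSliceIdx d) (U : (slicesInstance (kSliceIndex L a m2 hL i)).Bf.Cfg),
      EtaRateIneqSite (d + 1) (-2) (slicesGSite (kSliceIndex L a m2 hL i)) C δ (γ / 2) U := by
  obtain ⟨C, δ, hC, hδ, H⟩ := line1_kSlices (d := d) L hd hLodd hL ha hm hγ0 hγ1
  exact ⟨C, δ, hC, hδ, fun i U => (etaRateIneqSite_slicesG_iff_line1 (kSliceIndex L a m2 hL i) C δ (γ / 2) U).2 (H i)⟩

/-- **`NE2PlusSite` FOR KING'S `A = 0` SLICES THROUGH THE ABSTRACT PIPELINE, HYPOTHESIS-FREE** (`d ≥ 1`, odd `L ≥ 3`, `a, m² > 0`, `0 < γ ≤ 1`;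
every `c35`): on the family `kSliceIndex L a m² hL : KSliceIdx d → SlicesIndex (d+1)` — all volumes, all internal slices `j ≥ 1`, all spacing
ratios `n ≥ 1` — `NE2PlusSite (d+1) (−2) c35` holds for the slices' sup-over-the-fibres η-difference entries, constants `(M₅, δ, a₀, C, γ′) =
(1, δ, 1, C, γ∕2)` (part E's producer `ne2PlusSite_slicesG_of_line1`).  THE SLICE FAMILY OF PARTS D–E HAS A GENUINE MEMBER CLASS: King's `A = 0`
single-scale pieces (KING-TYPE, part F (ii)–(iii)).  HONEST SCOPE: `A = 0`, one-point backgrounds, NOT a discharge. [cite: King1986, Prop. 3.9 (3.73) p.665, (4.42)–(4.43) p.675; Balaban1985BackgroundPropagators, Thm 3.2 (3.48) p.398 + Thm 3.14 pp.426–427 (quantifier template)] -/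
theorem ne2PlusSite_kSlices (hd : 1 ≤ d) (hLodd : Odd L) (hL : 2 ≤ L) {a m2 : ℝ} (ha : 0 < a) (hm : 0 < m2) {γ : ℝ} (hγ0 : 0 < γ)
    (hγ1 : γ ≤ 1) (c35 : ℝ) :
    NE2PlusSite (d + 1) (-2) c35 (fun i : KSliceIdx d => slicesInstance (kSliceIndex L a m2 hL i))
      (fun i => slicesGSite (kSliceIndex L a m2 hL i)) := by
  obtain ⟨C, δ, hC, hδ, H⟩ := line1_kSlices (d := d) L hd hLodd hL ha hm hγ0.le hγ1
  exact ne2PlusSite_slicesG_of_line1 (kSliceIndex L a m2 hL) hC hδ (half_pos hγ0) H c35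

/-- `NE2ZeroSite` for King's `A = 0` slices (the site twin at the one configuration). [cite: King1986, Prop. 3.9 (3.73) p.665] -/
theorem ne2ZeroSite_kSlices (hd : 1 ≤ d) (hLodd : Odd L) (hL : 2 ≤ L) {a m2 : ℝ} (ha : 0 < a) (hm : 0 < m2) {γ : ℝ} (hγ0 : 0 < γ)
    (hγ1 : γ ≤ 1) :
    NE2ZeroSite (d + 1) (-2) (fun i : KSliceIdx d => slicesInstance (kSliceIndex L a m2 hL i))
      (fun i => slicesGSite (kSliceIndex L a m2 hL i)) :=
  ne2ZeroSite_of_ne2PlusSite (c35 := 0) (fun _ _ _ => trivial) (ne2PlusSite_kSlices L hd hLodd hL ha hm hγ0 hγ1 0)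

/-- ROUND TRIP (smoke): part E's readout applied to the member class returns (3.73) line 1's shape with positive constants above a cube-size
threshold — the packaged statement for King's `A = 0` slices is neither vacuous nor more than line 1. [cite: King1986, Prop. 3.9 (3.73) p.665] -/
theorem exists_line1_kSlices (hd : 1 ≤ d) (hLodd : Odd L) (hL : 2 ≤ L) {a m2 : ℝ} (ha : 0 < a) (hm : 0 < m2) {γ : ℝ} (hγ0 : 0 < γ)
    (hγ1 : γ ≤ 1) :
    ∃ M₅ C' δ γ' : ℝ, 0 < C' ∧ 0 < δ ∧ 0 < γ' ∧ ∀ i : KSliceIdx d, M₅ ≤ (kSliceIndex L a m2 hL i).M →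
      ∀ x' y' : (kSliceIndex L a m2 hL i).T.hi.S,
        |(kSliceIndex L a m2 hL i).T.hi.G (kSliceIndex L a m2 hL i).j x' y'
            - (kSliceIndex L a m2 hL i).T.lo.G (kSliceIndex L a m2 hL i).j ((kSliceIndex L a m2 hL i).T.pt x')
                ((kSliceIndex L a m2 hL i).T.pt y')|
          ≤ C' * ((kSliceIndex L a m2 hL i).T.lo.L : ℝ) ^ (-(γ' * (kSliceIndex L a m2 hL i).T.lo.k))
            * ((kSliceIndex L a m2 hL i).T.lo.slice (kSliceIndex L a m2 hL i).j) ^ ((2 : ℝ) - ((d + 1 : ℕ) : ℝ) - γ')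
            * Real.exp (-(δ * ((kSliceIndex L a m2 hL i).T.lo.slice (kSliceIndex L a m2 hL i).j)⁻¹
                * (kSliceIndex L a m2 hL i).T.lo.dist ((kSliceIndex L a m2 hL i).T.pt x') ((kSliceIndex L a m2 hL i).T.pt y'))) :=
  exists_line1_of_ne2PlusSite_slicesG (kSliceIndex L a m2 hL) (ne2PlusSite_kSlices L hd hLodd hL ha hm hγ0 hγ1 0)

end Pipeline

end Summit.QuantumFields.YangMills.BalabanUVNodes.N15KingModelRung.Curved

end
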